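import Literature.NumberTheory.Transcendental.PhilipponZeroEstimateLeibniz
import HarnessLib

/-!
# Philippon's zero estimate on `𝔾ₐ × 𝔾ₘ^n`: special ideals and the ideals `∂^T_Σ(I)`

Topic `Literature/NumberTheory/Transcendental`. Fourth module of the inline discharge of
`Literature.NumberTheory.Transcendental.Philippon1986_GaGm` (multiplicities): the ideal-theoretic
operations of D. Roy's exposition (Nesterenko–Philippon (eds.), LNM 1752, Ch. 11, §2.3 and §3.2)
made affine for `G = 𝔾ₐ × 𝔾ₘ^n`, whose coordinate ring `𝒪(G) = ℂ[X, Y^{±1}]` is the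
localisation of `B = ℂ[X, Y₁, …, Y_n]` at the torus unit `u = Y₁⋯Y_n` (`GaGm.torusUnit`,
`GaGmZariski.lean`). PROVED here (no named facts):

* `GaGm.sat I = (I : u^∞) = {P ; ∃ k, u^k P ∈ I}` — Roy's `I^*` ("the intersection of the primary
  components whose zero set meets `G`", Def. 2.1): `le_sat`, `sat_sat`, `zeroSet_sat`,
  `radical_sat` (`√(I^*) = 𝔍(Z(I))`, the Nullstellensatz in `G` of `GaGmZariski.lean`),
  `sat_eq_top_iff` (`I^* = (1) ↔ Z(I) = ∅`), `sat_vanishing`;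
* `GaGm.dIdeal W S T I = ∂^T_Σ(I)` — the special ideal generated by the translates `shift σ`,
  `σ ∈ Σ = S`, of the words of length `≤ T` in the invariant derivations `D_u`, `u ∈ W`, applied to
  the members of `I` (Roy, Def. 3.5 with Prop. 3.6 (iv) as the definition, legitimate here since
  all these operators are global polynomial maps), and Roy's **Proposition 3.6**:
  (i) `dIdeal W {e} 0 I = I^*` (`dIdeal_one_zero`); (ii) **`dIdeal_dIdeal`**:
  `∂^{T'}_{Σ'}(∂^T_Σ(I)) = ∂^{T'+T}_{Σ'·Σ}(I)`; (iii) **`zeroSet_dIdeal`**: the zeros of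
  `∂^T_Σ(I)` in `G` are the `a` such that every `P ∈ I` vanishes to order `> T` along `exp_G(W)`
  at `σ·a` for all `σ ∈ Σ` (`GaGm.VanishesToOrder`, via `vanishesToOrder_iff_wordDeriv`);
  (iv) **`dIdeal_sat_span`** / `dGensOf_subset_Box`: if `I = (E)^*` with `E ⊆ Box(t)` then
  `∂^T_Σ(I) = (E')^*` with `E' ⊆ Box(t)` (`c(G) = 1`).

## References

* Yu. V. Nesterenko, P. Philippon (eds.), *Introduction to Algebraic Independence Theory*,
  LNM 1752, Springer 2001, Ch. 11 (D. Roy), Def. 2.1 (p. 201), Def. 3.5, Prop. 3.6 (pp. 207–214).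
* P. Philippon, *Lemmes de zéros dans les groupes algébriques commutatifs*, Bull. Soc. Math.
  France 114 (1986), 355–383, Déf. 4.2, Prop. 4.3, Prop. 4.4.
-/

noncomputable section

open MvPolynomial
open scoped Pointwise

namespace Literature.NumberTheory.Transcendental

namespace GaGm

variable {n : ℕ}

/-! ### Special ideals: saturation by the torus unit -/

/-- **Roy's `I^*`** for ideals of `B = ℂ[X, Y₁, …, Y_n]`: the saturation
`(I : u^∞) = {P ; ∃ k, u^k · P ∈ I}` by the torus unit `u = Y₁⋯Y_n` — the contraction to `B` of
the extension of `I` to the coordinate ring `B[u⁻¹]` of `G`. This is the special case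
`Literature.AlgebraicGeometry.Resolution.satPowers I (torusUnit n)` of the general `u`-saturation
of `SpreadingOutAlgebra.lean` (`mem_satPowers_iff` has the same orientation as `mem_sat_iff`, and
`satPowers_eq_comap_map` is the contraction statement); it is kept as a local definition only to
avoid importing the `AlgebraicGeometry/Resolution`–`Limits` cone into this chain, and the two may
be collapsed by `ext P; exact mem_satPowers_iff.symm`. [cite: NesterenkoPhilippon2001, Ch. 11 Def. 2.1] -/
def sat (I : Ideal (MvPolynomial (Fin (n + 1)) ℂ)) : Ideal (MvPolynomial (Fin (n + 1)) ℂ) where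
  carrier := {P | ∃ k : ℕ, torusUnit n ^ k * P ∈ I}
  zero_mem' := ⟨0, by simp⟩
  add_mem' := by
    rintro P Q ⟨k, hk⟩ ⟨l, hl⟩
    refine ⟨k + l, ?_⟩
    rw [mul_add]
    refine I.add_mem ?_ ?_
    · rw [pow_add, mul_comm (torusUnit n ^ k), mul_assoc]
      exact I.mul_mem_left _ hk
    · rw [pow_add, mul_assoc]
      exact I.mul_mem_left _ hl
  smul_mem' := by
    rintro c P ⟨k, hk⟩
    refine ⟨k, ?_⟩
    rw [smul_eq_mul, mul_left_comm]
    exact I.mul_mem_left c hk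

/-- Membership in `I^*`. [folklore] -/
theorem mem_sat_iff {I : Ideal (MvPolynomial (Fin (n + 1)) ℂ)} {P : MvPolynomial (Fin (n + 1)) ℂ} :
    P ∈ sat I ↔ ∃ k : ℕ, torusUnit n ^ k * P ∈ I := Iff.rfl

/-- `I ⊆ I^*`. [folklore] -/
theorem le_sat (I : Ideal (MvPolynomial (Fin (n + 1)) ℂ)) : I ≤ sat I :=
  fun P hP => ⟨0, by simpa using hP⟩

/-- `I ↦ I^*` is monotone. [folklore] -/
theorem sat_mono {I J : Ideal (MvPolynomial (Fin (n + 1)) ℂ)} (h : I ≤ J) : sat I ≤ sat J :=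
  fun _ ⟨k, hk⟩ => ⟨k, h hk⟩

/-- `(I^*)^* = I^*`. [folklore] -/
theorem sat_sat (I : Ideal (MvPolynomial (Fin (n + 1)) ℂ)) : sat (sat I) = sat I := by
  refine le_antisymm ?_ (le_sat _)
  rintro P ⟨k, l, hkl⟩
  refine ⟨l + k, ?_⟩
  rwa [pow_add, mul_assoc]

/-- `I^*` is saturated: `u^k P ∈ I^* ⇒ P ∈ I^*`. [folklore] -/
theorem mem_sat_of_torusUnit_pow_mul {I : Ideal (MvPolynomial (Fin (n + 1)) ℂ)}
    {P : MvPolynomial (Fin (n + 1)) ℂ} {k : ℕ} (h : torusUnit n ^ k * P ∈ sat I) : P ∈ sat I := by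
  rw [← sat_sat I]
  exact ⟨k, h⟩

/-- `Z(I^*) = Z(I)` in `G` (`u` does not vanish on `G`). [folklore] -/
theorem zeroSet_sat (I : Ideal (MvPolynomial (Fin (n + 1)) ℂ)) :
    zeroSet (n := n) (sat I) = zeroSet I := by
  refine Set.Subset.antisymm (zeroSet_antitone (le_sat I)) fun g hg P ⟨k, hk⟩ => ?_
  have h := hg _ hk
  rw [evalAt_eq_eval, map_mul, map_pow] at h
  rcases mul_eq_zero.mp h with h' | h'
  · exact absurd (eq_zero_of_pow_eq_zero h') (evalAt_torusUnit_ne_zero g)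
  · exact h'

/-- **`√(I^*) = 𝔍(Z(I))`** (the Nullstellensatz in `G(ℂ)`, `GaGm.mem_vanishing_zeroSet_iff`).
[folklore] -/
theorem radical_sat (I : Ideal (MvPolynomial (Fin (n + 1)) ℂ)) :
    (sat I).radical = vanishing (zeroSet (n := n) I) := by
  ext P
  rw [mem_vanishing_zeroSet_iff, Ideal.mem_radical_iff]
  constructor
  · rintro ⟨k, l, hkl⟩
    refine ⟨k + l, ?_⟩
    have : (P * torusUnit n) ^ (k + l) = (P ^ l * torusUnit n ^ k) * (torusUnit n ^ l * P ^ k) := by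
      ring
    rw [this]
    exact I.mul_mem_left _ hkl
  · rintro ⟨k, hk⟩
    refine ⟨k, k, ?_⟩
    rwa [← mul_pow, mul_comm]

/-- `I^* = (1)` iff `I` has no zero in `G`. [folklore] -/
theorem sat_eq_top_iff (I : Ideal (MvPolynomial (Fin (n + 1)) ℂ)) :
    sat I = ⊤ ↔ zeroSet (n := n) I = ∅ := by
  constructor
  · intro h
    rw [← zeroSet_sat, h]
    exact Set.eq_empty_of_forall_notMem fun g hg => by simpa [evalAt_eq_eval] using hg 1 trivial
  · intro h
    have h1 : (1 : MvPolynomial (Fin (n + 1)) ℂ) ∈ (sat I).radical := by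
      rw [radical_sat, h, vanishing_empty]
      trivial
    obtain ⟨k, hk⟩ := h1
    rw [one_pow] at hk
    exact (Ideal.eq_top_iff_one _).mpr hk

/-- Vanishing ideals are special: `𝔍(X)^* = 𝔍(X)`. [folklore] -/
theorem sat_vanishing (X : Set (GaGm n)) : sat (vanishing X) = vanishing X := by
  refine le_antisymm (fun P ⟨k, hk⟩ => ?_) (le_sat _)
  induction k with
  | zero => simpa using hk
  | succ k ih =>
    apply ih
    apply mem_vanishing_of_mul_torusUnit
    have e : torusUnit n ^ k * P * torusUnit n = torusUnit n ^ (k + 1) * P := by ring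
    rw [e]
    exact hk

/-- Translations map the torus unit to a non-zero constant multiple of itself. [folklore] -/
theorem shift_torusUnit (σ : GaGm n) :
    shift σ (torusUnit n) = C (∏ h : Fin n, ((σ.2 h : ℂˣ) : ℂ)) * torusUnit n := by
  simp only [torusUnit, map_prod, shift_X_succ, Finset.prod_mul_distrib, map_prod]

/-! ### Words applied to members of an ideal generated by a set -/

/-- The words of length `≤ N` in letters from `W` applied to the members of a SET `E`. [folklore] -/
def wordsOf (W : Submodule ℂ (ℂ × (Fin n → ℂ))) (N : ℕ) (E : Set (MvPolynomial (Fin (n + 1)) ℂ)) :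
    Set (MvPolynomial (Fin (n + 1)) ℂ) :=
  {R | ∃ e ∈ E, R ∈ wordsLE W N e}

/-- Words applied to a member of the IDEAL generated by `E` lie in the ideal generated by the
words applied to the members of `E` (Leibniz into spans). [folklore] -/
theorem wordDeriv_mem_span_wordsOf {W : Submodule ℂ (ℂ × (Fin n → ℂ))} {N : ℕ}
    {E : Set (MvPolynomial (Fin (n + 1)) ℂ)} {F : MvPolynomial (Fin (n + 1)) ℂ}
    (hF : F ∈ Ideal.span E) {j : ℕ} (hj : j ≤ N) (v : Fin j → ℂ × (Fin n → ℂ)) (hv : ∀ i, v i ∈ W) :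
    wordDeriv v F ∈ Ideal.span (wordsOf W N E) := by
  revert j
  refine Submodule.span_induction (p := fun F _ => ∀ {j : ℕ}, j ≤ N → ∀ (v : Fin j → ℂ × (Fin n → ℂ)),
      (∀ i, v i ∈ W) → wordDeriv v F ∈ Ideal.span (wordsOf W N E)) ?_ ?_ ?_ ?_ hF
  · intro e he j hj v hv
    exact Ideal.subset_span ⟨e, he, j, hj, v, hv, rfl⟩
  · intro j _ v _
    rw [wordDeriv_zero_right]
    exact Ideal.zero_mem _
  · intro x y _ _ hx hy j hj v hv
    rw [wordDeriv_add]
    exact Ideal.add_mem _ (hx hj v hv) (hy hj v hv)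
  · intro a x _ hx j hj v hv
    rw [smul_eq_mul]
    refine (Ideal.span_le.mpr ?_) (wordDeriv_mul_mem_span v hv a x)
    rintro _ ⟨j', hj', v', hv', rfl⟩
    exact hx (hj'.trans hj) v' hv'

/-- **Key lemma** (compatibility of translates of words with special ideals): for
`Q ∈ (E)^*`, `σ ∈ G` and a word `v` of length `j` in letters from `W`,
`shift σ (D_v Q) ∈ (shift σ (wordsOf W j E))^*`. [folklore] -/
theorem shift_wordDeriv_mem_sat_span {W : Submodule ℂ (ℂ × (Fin n → ℂ))}
    {E : Set (MvPolynomial (Fin (n + 1)) ℂ)} {Q : MvPolynomial (Fin (n + 1)) ℂ}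
    (hQ : Q ∈ sat (Ideal.span E)) (σ : GaGm n) {j : ℕ} (v : Fin j → ℂ × (Fin n → ℂ))
    (hv : ∀ i, v i ∈ W) :
    shift σ (wordDeriv v Q) ∈ sat (Ideal.span (shift σ '' wordsOf W j E)) := by
  obtain ⟨k, hk⟩ := hQ
  -- `u^k D_v Q ∈ (wordsOf W j E)` in `B`
  have h1 : torusUnit n ^ k * wordDeriv v Q ∈ Ideal.span (wordsOf W j E) := by
    have h := torusUnit_pow_mul_wordDeriv_mem_span k v hv Q
    have hle : Submodule.span ℂ (wordsLE W j (torusUnit n ^ k * Q)) ≤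
        (Ideal.span (wordsOf W j E)).restrictScalars ℂ := Submodule.span_le.mpr (by
      rintro _ ⟨j', hj', v', hv', rfl⟩
      exact wordDeriv_mem_span_wordsOf hk hj' v' hv')
    exact hle h
  -- apply `shift σ`: `shift σ (u^k) = c u^k`, `c ≠ 0`
  have h2 : shift σ (torusUnit n ^ k * wordDeriv v Q) ∈ Ideal.span (shift σ '' wordsOf W j E) := by
    rw [← Ideal.map_span]
    exact Ideal.mem_map_of_mem _ h1
  set c : ℂ := (∏ h : Fin n, ((σ.2 h : ℂˣ) : ℂ)) ^ k with hc
  have hc0 : c ≠ 0 := pow_ne_zero _ (Finset.prod_ne_zero_iff.mpr fun h _ => (σ.2 h).ne_zero)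
  rw [map_mul, map_pow, shift_torusUnit, mul_pow, ← map_pow, ← hc] at h2
  refine ⟨k, ?_⟩
  have h3 := Ideal.mul_mem_left _ (C c⁻¹) h2
  have e : C c⁻¹ * (C c * torusUnit n ^ k * shift σ (wordDeriv v Q)) =
      torusUnit n ^ k * shift σ (wordDeriv v Q) := by
    rw [← mul_assoc, ← mul_assoc, ← map_mul, inv_mul_cancel₀ hc0, map_one, one_mul]
  rwa [e] at h3

/-! ### The ideals `∂^T_Σ(I)` -/

/-- The generators of `∂^T_Σ(I)`: translates by `σ ∈ Σ` of words of length `≤ T` (letters in `W`)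
applied to members of `I`. [cite: NesterenkoPhilippon2001, Ch. 11 Def. 3.5 / Prop. 3.6 (iv)] -/
def dGens (W : Submodule ℂ (ℂ × (Fin n → ℂ))) (S : Set (GaGm n)) (T : ℕ)
    (E : Set (MvPolynomial (Fin (n + 1)) ℂ)) : Set (MvPolynomial (Fin (n + 1)) ℂ) :=
  {Q | ∃ σ ∈ S, ∃ R ∈ wordsOf W T E, Q = shift σ R}

/-- **Roy's `∂^T_Σ(I)`** for `G = 𝔾ₐ × 𝔾ₘ^n`, `A = exp_G(W)`: the special ideal
`(shift σ (D_{u₁}⋯D_{u_j} P) ; σ ∈ Σ, j ≤ T, uᵢ ∈ W, P ∈ I)^*` of `B = ℂ[X, Y₁, …, Y_n]`.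
[cite: NesterenkoPhilippon2001, Ch. 11 Def. 3.5] -/
def dIdeal (W : Submodule ℂ (ℂ × (Fin n → ℂ))) (S : Set (GaGm n)) (T : ℕ)
    (I : Ideal (MvPolynomial (Fin (n + 1)) ℂ)) : Ideal (MvPolynomial (Fin (n + 1)) ℂ) :=
  sat (Ideal.span (dGens W S T (I : Set (MvPolynomial (Fin (n + 1)) ℂ))))

variable {W : Submodule ℂ (ℂ × (Fin n → ℂ))}

/-- `∂^T_Σ(I)` is special. [folklore] -/
theorem sat_dIdeal (S : Set (GaGm n)) (T : ℕ) (I : Ideal (MvPolynomial (Fin (n + 1)) ℂ)) :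
    sat (dIdeal W S T I) = dIdeal W S T I :=
  sat_sat _

/-- `dGens` is monotone in all its arguments. [folklore] -/
theorem dGens_mono {S S' : Set (GaGm n)} (hS : S ⊆ S') {T T' : ℕ} (hT : T ≤ T')
    {E E' : Set (MvPolynomial (Fin (n + 1)) ℂ)} (hE : E ⊆ E') : dGens W S T E ⊆ dGens W S' T' E' := by
  rintro _ ⟨σ, hσ, R, ⟨e, he, hR⟩, rfl⟩
  exact ⟨σ, hS hσ, R, ⟨e, hE he, wordsLE_mono W hT e hR⟩, rfl⟩

/-- `∂^T_Σ` is monotone in `Σ`, `T` and `I`. [folklore] -/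
theorem dIdeal_mono {S S' : Set (GaGm n)} (hS : S ⊆ S') {T T' : ℕ} (hT : T ≤ T')
    {I I' : Ideal (MvPolynomial (Fin (n + 1)) ℂ)} (hI : I ≤ I') : dIdeal W S T I ≤ dIdeal W S' T' I' :=
  sat_mono (Ideal.span_mono (dGens_mono hS hT hI))

/-- `I ⊆ ∂^T_Σ(I)` when `e ∈ Σ`. [folklore] -/
theorem le_dIdeal {S : Set (GaGm n)} (hS : (1 : GaGm n) ∈ S) (T : ℕ)
    (I : Ideal (MvPolynomial (Fin (n + 1)) ℂ)) : I ≤ dIdeal W S T I := fun P hP =>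
  le_sat _ (Ideal.subset_span ⟨1, hS, P, ⟨P, hP, self_mem_wordsLE W T P⟩, by rw [shift_one]; rfl⟩)

/-- **Prop. 3.6 (i)**: `∂⁰_{e}(I) = I^*`. [cite: NesterenkoPhilippon2001, Ch. 11 Prop. 3.6 (i)] -/
theorem dIdeal_one_zero (I : Ideal (MvPolynomial (Fin (n + 1)) ℂ)) :
    dIdeal W {(1 : GaGm n)} 0 I = sat I := by
  have h : dGens W {(1 : GaGm n)} 0 (I : Set (MvPolynomial (Fin (n + 1)) ℂ)) = I := by
    ext Q
    constructor
    · rintro ⟨σ, hσ, R, ⟨e, he, j, hj, u, -, rfl⟩, rfl⟩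
      obtain rfl : j = 0 := Nat.le_zero.mp hj
      rw [Set.mem_singleton_iff.mp hσ, shift_one, wordDeriv_zero]
      exact he
    · intro hQ
      exact ⟨1, rfl, Q, ⟨Q, hQ, self_mem_wordsLE W 0 Q⟩, by rw [shift_one]; rfl⟩
  rw [dIdeal, h, Ideal.span_eq]

/-- **Prop. 3.6 (iii)** — the zeros of `∂^T_Σ(I)` in `G`: `a ∈ Z(∂^T_Σ(I))` iff every `P ∈ I`
vanishes to order `> T` along `exp_G(W)` at `σ·a` for every `σ ∈ Σ`.
[cite: NesterenkoPhilippon2001, Ch. 11 Prop. 3.6 (iii)] -/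
theorem zeroSet_dIdeal (S : Set (GaGm n)) (T : ℕ) (I : Ideal (MvPolynomial (Fin (n + 1)) ℂ)) :
    zeroSet (dIdeal W S T I) = {a | ∀ P ∈ I, ∀ σ ∈ S, VanishesToOrder P W (σ * a) (T + 1)} := by
  rw [dIdeal, zeroSet_sat, zeroSet_span]
  ext a
  simp only [mem_zeroSet_iff, Set.mem_setOf_eq]
  constructor
  · intro h P hP σ hσ
    rw [vanishesToOrder_iff_wordDeriv]
    intro k hk u hu
    rw [← evalAt_shift]
    exact h _ ⟨σ, hσ, _, ⟨P, hP, k, Nat.lt_succ_iff.mp hk, u, hu, rfl⟩, rfl⟩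
  · rintro h _ ⟨σ, hσ, R, ⟨P, hP, j, hj, u, hu, rfl⟩, rfl⟩
    rw [evalAt_shift]
    exact (vanishesToOrder_iff_wordDeriv P W (σ * a) (T + 1)).mp (h P hP σ hσ) j
      (Nat.lt_succ_iff.mpr hj) u hu

/-- **Saturation invariance**: `∂^T_Σ(I^*) = ∂^T_Σ(I)` (implicit in Roy's Def. 3.5, where
`∂^T_Σ` is defined through the extensions `I·𝒪(U)`; not printed as part of Prop. 3.6).
[cite: NesterenkoPhilippon2001, Ch. 11 Def. 3.5] -/
theorem dIdeal_sat (S : Set (GaGm n)) (T : ℕ) (I : Ideal (MvPolynomial (Fin (n + 1)) ℂ)) :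
    dIdeal W S T (sat I) = dIdeal W S T I := by
  refine le_antisymm ?_ (dIdeal_mono Set.Subset.rfl le_rfl (le_sat I))
  -- generators of the left-hand side lie in the right-hand side
  rw [dIdeal, ← sat_dIdeal S T I]
  refine sat_mono (Ideal.span_le.mpr ?_)
  rintro _ ⟨σ, hσ, R, ⟨Q, hQ, j, hj, v, hv, rfl⟩, rfl⟩
  have hQ' : Q ∈ sat (Ideal.span (I : Set (MvPolynomial (Fin (n + 1)) ℂ))) := by rwa [Ideal.span_eq]
  refine sat_mono (Ideal.span_mono ?_) (shift_wordDeriv_mem_sat_span hQ' σ v hv)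
  rintro _ ⟨R, hR, rfl⟩
  obtain ⟨e, he, hRe⟩ := hR
  exact ⟨σ, hσ, R, ⟨e, he, wordsLE_mono W hj e hRe⟩, rfl⟩

/-- **Prop. 3.6 (iv), generators**: `∂^T_Σ((E)) = (dGens W Σ T E)^*` — the ideal `∂^T_Σ` of the
ideal generated by a set `E` is the special ideal generated by the translated words applied to the
members of `E` themselves. [cite: NesterenkoPhilippon2001, Ch. 11 Prop. 3.6 (iv)] -/
theorem dIdeal_span (S : Set (GaGm n)) (T : ℕ) (E : Set (MvPolynomial (Fin (n + 1)) ℂ)) :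
    dIdeal W S T (Ideal.span E) = sat (Ideal.span (dGens W S T E)) := by
  refine le_antisymm ?_ (sat_mono (Ideal.span_mono (dGens_mono Set.Subset.rfl le_rfl
    Ideal.subset_span)))
  rw [dIdeal, ← sat_sat (Ideal.span (dGens W S T E))]
  refine sat_mono (Ideal.span_le.mpr ?_)
  rintro _ ⟨σ, hσ, R, ⟨Q, hQ, j, hj, v, hv, rfl⟩, rfl⟩
  refine sat_mono (Ideal.span_mono ?_)
    (shift_wordDeriv_mem_sat_span (le_sat _ (hQ : Q ∈ Ideal.span E)) σ v hv)
  rintro _ ⟨R, ⟨e, he, hRe⟩, rfl⟩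
  exact ⟨σ, hσ, R, ⟨e, he, wordsLE_mono W hj e hRe⟩, rfl⟩

/-- **Prop. 3.6 (iv)** combined with the saturation invariance: `∂^T_Σ((E)^*) = (dGens W Σ T E)^*`.
[cite: NesterenkoPhilippon2001, Ch. 11 Prop. 3.6 (iv) with Def. 3.5] -/
theorem dIdeal_sat_span (S : Set (GaGm n)) (T : ℕ) (E : Set (MvPolynomial (Fin (n + 1)) ℂ)) :
    dIdeal W S T (sat (Ideal.span E)) = sat (Ideal.span (dGens W S T E)) := by
  rw [dIdeal_sat, dIdeal_span]

/-- The generators keep the box degrees: `E ⊆ Box(t) ⇒ dGens W Σ T E ⊆ Box(t)` (translations and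
invariant derivations have `c = 1` on the linear group). [cite: NesterenkoPhilippon2001, Ch. 11 Prop. 3.6 (iv)] -/
theorem dGens_subset_Box {D₀ D₁ t : ℕ} {S : Set (GaGm n)} {T : ℕ}
    {E : Set (MvPolynomial (Fin (n + 1)) ℂ)}
    (hE : E ⊆ (Box (n := n) D₀ D₁ t : Set (MvPolynomial (Fin (n + 1)) ℂ))) :
    dGens W S T E ⊆ (Box (n := n) D₀ D₁ t : Set (MvPolynomial (Fin (n + 1)) ℂ)) := by
  rintro _ ⟨σ, -, R, ⟨e, he, j, -, u, -, rfl⟩, rfl⟩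
  exact shift_mem_Box σ (wordDeriv_mem_Box u (hE he))

/-! ### Prop. 3.6 (ii): composition -/

/-- Splitting a word of length `≤ a + b` into an outer part of length `≤ a` and an inner part of
length `≤ b`. [folklore] -/
theorem exists_split_word (P : MvPolynomial (Fin (n + 1)) ℂ) :
    ∀ (j : ℕ) (w : Fin j → ℂ × (Fin n → ℂ)), (∀ i, w i ∈ W) → ∀ (a b : ℕ), j ≤ a + b →
      ∃ (j₂ : ℕ), j₂ ≤ b ∧ ∃ u : Fin j₂ → ℂ × (Fin n → ℂ), (∀ i, u i ∈ W) ∧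
        wordDeriv w P ∈ wordsLE W a (wordDeriv u P) := by
  intro j
  induction j with
  | zero =>
    intro w _ a b _
    exact ⟨0, Nat.zero_le _, Fin.elim0, fun i => i.elim0, self_mem_wordsLE W a _⟩
  | succ j ih =>
    intro w hw a b hab
    rcases Nat.eq_zero_or_pos a with rfl | ha
    · exact ⟨j + 1, by omega, w, hw, self_mem_wordsLE W 0 _⟩
    · have hsplit : w = Fin.cons (w 0) (Fin.tail w) := (Fin.cons_self_tail w).symm
      obtain ⟨j₂, hj₂, u, hu, j₁, hj₁, v, hv, hvu⟩ := ih (Fin.tail w) (fun i => hw _) (a - 1) b (by omega)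
      refine ⟨j₂, hj₂, u, hu, j₁ + 1, by omega, Fin.cons (w 0) v,
        fun i => Fin.cases (hw 0) (fun i' => hv i') i, ?_⟩
      rw [show wordDeriv w P = wordDeriv (Fin.cons (w 0) (Fin.tail w) : Fin (j + 1) → _) P by
        rw [← hsplit], wordDeriv_cons, hvu, wordDeriv_cons]

/-- **Prop. 3.6 (ii)**: `∂^{T'}_{Σ'}(∂^T_Σ(I)) = ∂^{T'+T}_{Σ'·Σ}(I)`.
[cite: NesterenkoPhilippon2001, Ch. 11 Prop. 3.6 (ii)] -/
theorem dIdeal_dIdeal (S' S : Set (GaGm n)) (T' T : ℕ) (I : Ideal (MvPolynomial (Fin (n + 1)) ℂ)) :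
    dIdeal W S' T' (dIdeal W S T I) = dIdeal W (S' * S) (T' + T) I := by
  apply le_antisymm
  · -- `⊆`: use the saturated-generator description of the inner ideal
    have h1 : dIdeal W S' T' (dIdeal W S T I) =
        sat (Ideal.span (dGens W S' T' (dGens W S T (I : Set (MvPolynomial (Fin (n + 1)) ℂ))))) :=
      dIdeal_sat_span S' T' _
    rw [h1, dIdeal, ← sat_sat (Ideal.span (dGens W (S' * S) _ _))]
    refine sat_mono (Ideal.span_le.mpr ?_)
    rintro _ ⟨γ, hγ, R, ⟨_, ⟨σ, hσ, R₀, ⟨P, hP, hR₀⟩, rfl⟩, j, hj, v, hv, rfl⟩, rfl⟩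
    refine le_sat _ (Ideal.subset_span ⟨γ * σ, Set.mul_mem_mul hγ hσ, wordDeriv v R₀, ?_, ?_⟩)
    · obtain ⟨j₀, hj₀, u, hu, rfl⟩ := hR₀
      have h := wordDeriv_mem_wordsLE (W := W) (g := P) (Q := wordDeriv u P) ⟨j₀, le_rfl, u, hu, rfl⟩ v hv
      exact ⟨P, hP, wordsLE_mono W (by omega) P h⟩
    · rw [← transl_eq_shift σ, ← transl_wordDeriv, transl_eq_shift, show γ * σ = σ * γ from mul_comm _ _,
        shift_mul, AlgHom.comp_apply]
  · -- `⊇`: split the words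
    refine sat_mono (Ideal.span_le.mpr ?_)
    rintro _ ⟨τ, hτ, R, ⟨P, hP, j, hj, w, hw, rfl⟩, rfl⟩
    obtain ⟨γ, hγ, σ, hσ, rfl⟩ := Set.mem_mul.mp hτ
    obtain ⟨j₂, hj₂, u, hu, j₁, hj₁, v, hv, hvu⟩ := exists_split_word (W := W) P j w hw T' T hj
    rw [hvu, show γ * σ = σ * γ from mul_comm γ σ, shift_mul, AlgHom.comp_apply, ← transl_eq_shift σ,
      transl_wordDeriv, transl_eq_shift]
    -- `shift γ (D_v g)` with `g = shift σ (D_u P)` a generator of the inner ideal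
    refine Ideal.subset_span ⟨γ, hγ, wordDeriv v (shift σ (wordDeriv u P)), ⟨_, ?_, j₁, hj₁, v, hv, rfl⟩, rfl⟩
    exact le_sat _ (Ideal.subset_span ⟨σ, hσ, wordDeriv u P, ⟨P, hP, j₂, hj₂, u, hu, rfl⟩, rfl⟩)

/-- Roy's iteration `I_{k+1} = ∂^T_Σ(I_k)`: `(∂^T_Σ)^k (I) = ∂^{kT}_{Σ(k)}(I^*)` in the form
`(∂^T_Σ)^{k} (∂⁰_{e} I) = ∂^{kT}_{Σ^k}(I)` for the pointwise powers `Σ^k` of the set `Σ ∋ e`.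
[cite: NesterenkoPhilippon2001, Ch. 11 Thm. 4.1 (proof)] -/
theorem dIdeal_iterate (S : Set (GaGm n)) (T : ℕ) (I : Ideal (MvPolynomial (Fin (n + 1)) ℂ)) (k : ℕ) :
    (dIdeal W S T)^[k] (sat I) = dIdeal W (S ^ k) (k * T) I := by
  induction k with
  | zero =>
    simp only [Function.iterate_zero, id_eq, pow_zero, zero_mul]
    rw [← Set.singleton_one, dIdeal_one_zero]
  | succ k ih =>
    rw [Function.iterate_succ_apply', ih, dIdeal_dIdeal, pow_succ', Nat.succ_mul,
      Nat.add_comm T (k * T)]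

end GaGm

end Literature.NumberTheory.Transcendental
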